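import Mathlib
import HarnessLib
import Summits.Ventures.LatticeQCDFlow.Scoring.KArmPooledEstimate

/-!
# ANY FIXED-WEIGHT COMBINATION OF `k` CALIBRATED CODES IS CALIBRATED, AND THE INVERSE-VARIANCE
# POOLED ESTIMATE IS THE ASYMPTOTICALLY SHORTEST ONE: `(Σ_r s_r⁻¹)⁻¹ ≤ Σ_r w_r² s_r` FOR `Σ_r w_r = 1`

HONEST FRAMING: exact (Metropolis-corrected) sampling algorithms for lattice gauge theory;
figures of merit are autocorrelation/cost numbers at stated couplings and volumes; no
continuum-physics claim.

Venture `LatticeQCDFlow` (cell pub-lqcd), topic `Scoring`; FANOUT row 4 (`s0-u1-b`, GEN-35).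
NEW WORK of the cell (classical; our formalisation), no definition, nothing cited as a fact
(Gauss–Markov / "BLUE" and the Cauchy–Schwarz inequality NAMED ONLY).

WHY (row 4).  The default way of combining two agreeing implementations is the plain average
`(S^A + S^B)/2`; `Scoring/KArmPooledEstimate` studies the inverse-variance pooled estimate.  Both are
instances of a FIXED-WEIGHT combination `m̂ₖ^w = Σ_r w_r Sₖ^r` (`Σ_r w_r = 1`) with squared error bar
`V̂ₖ^w = Σ_r w_r² V̂ₖ^r`.  In the setting of `Scoring/KArmHomogeneityCoverage` (equal targets,
`√k(Sₖ^r − a) ⇒ N(0, s_r)` independent, `k·V̂ₖ^r → s_r > 0` a.s.) this file proves: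
(i) EVERY such combination is calibrated — `P((m̂ₖ^w − a)² ≤ z²·V̂ₖ^w) → N(0,1)([−|z|,|z|])`
(**`kArm_weighted_coverage`**; some `w_r ≠ 0`), with `k·V̂ₖ^w → Σ_r w_r² s_r` a.s.
(**`ae_tendsto_scaled_weightedErrorBar`**);
(ii) its asymptotic squared half-width `z²·Σ_r w_r² s_r` is AT LEAST the pooled one:
`(Σ_r s_r⁻¹)⁻¹ ≤ Σ_r w_r² s_r` (**`inv_sum_inv_le_weightedVariance`**, Cauchy–Schwarz), with
equality iff `w_r = s_r⁻¹/Σ_j s_j⁻¹` (**`weightedVariance_eq_inv_sum_inv_iff`**) — the inverse-variance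
weights are the unique asymptotically shortest calibrated fixed-weight combination; e.g. for two codes
the plain average is wider by the factor `(s_A + s_B)²/(4 s_A s_B) ≥ 1`, `= 1` iff `s_A = s_B`
(**`average_vs_pooled_two`**).

NOT CLAIMED: data-dependent weights other than `Scoring/KArmPooledEstimate`'s; finite `k`; numbers.
-/

open MeasureTheory ProbabilityTheory Filter Topology Finset

namespace Summit.Ventures.LatticeQCDFlow.Scoring

open Set WithLp

/-! ## §1 Algebra: Cauchy–Schwarz optimality of the inverse-variance weights -/

section Algebra

variable {R : ℕ}

/-- **`(Σ_r s_r⁻¹)⁻¹ ≤ Σ_r w_r² s_r` whenever `Σ_r w_r = 1`** (`s_r > 0`): no fixed-weight unbiased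
combination has smaller asymptotic variance than inverse-variance pooling (Cauchy–Schwarz with
`w_r = (w_r √s_r)·(1/√s_r)`). [ours] -/
theorem inv_sum_inv_le_weightedVariance [NeZero R] (s w : Fin R → ℝ) (hs : ∀ r, 0 < s r)
    (hw : ∑ r, w r = 1) :
    (∑ r, (s r)⁻¹)⁻¹ ≤ ∑ r, w r ^ 2 * s r := by
  have hW : 0 < ∑ r, (s r)⁻¹ := Finset.sum_pos (fun j _ => inv_pos.2 (hs j)) Finset.univ_nonempty
  -- Cauchy–Schwarz: (Σ w)² = (Σ (w√s)(1/√s))² ≤ (Σ w² s)(Σ 1/s)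
  have hcs : (∑ r, w r) ^ 2 ≤ (∑ r, w r ^ 2 * s r) * (∑ r, (s r)⁻¹) := by
    have e1 : ∀ r, w r * Real.sqrt (s r) * (Real.sqrt (s r))⁻¹ = w r := fun r => by
      rw [mul_assoc, mul_inv_cancel₀ (Real.sqrt_pos.2 (hs r)).ne', mul_one]
    have e2 : ∀ r, (w r * Real.sqrt (s r)) ^ 2 = w r ^ 2 * s r := fun r => by
      rw [mul_pow, Real.sq_sqrt (hs r).le]
    have e3 : ∀ r, ((Real.sqrt (s r))⁻¹) ^ 2 = (s r)⁻¹ := fun r => by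
      rw [inv_pow, Real.sq_sqrt (hs r).le]
    calc (∑ r, w r) ^ 2 = (∑ r, w r * Real.sqrt (s r) * (Real.sqrt (s r))⁻¹) ^ 2 := by
          simp only [e1]
      _ ≤ (∑ r, (w r * Real.sqrt (s r)) ^ 2) * (∑ r, ((Real.sqrt (s r))⁻¹) ^ 2) :=
          Finset.sum_mul_sq_le_sq_mul_sq _ _ _
      _ = (∑ r, w r ^ 2 * s r) * (∑ r, (s r)⁻¹) := by simp only [e2, e3]
  rw [hw, one_pow] at hcs
  rw [inv_le_iff_one_le_mul₀ hW]
  linarith [hcs]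

/-- **Equality iff the weights are the inverse-variance weights**: `Σ_r w_r = 1`, `s_r > 0` ⇒
`Σ_r w_r² s_r = (Σ_r s_r⁻¹)⁻¹ ↔ ∀ r, w_r = s_r⁻¹/Σ_j s_j⁻¹`. [ours] -/
theorem weightedVariance_eq_inv_sum_inv_iff [NeZero R] (s w : Fin R → ℝ) (hs : ∀ r, 0 < s r)
    (hw : ∑ r, w r = 1) :
    ∑ r, w r ^ 2 * s r = (∑ r, (s r)⁻¹)⁻¹ ↔ ∀ r, w r = (s r)⁻¹ / ∑ j, (s j)⁻¹ := by
  have hW : 0 < ∑ r, (s r)⁻¹ := Finset.sum_pos (fun j _ => inv_pos.2 (hs j)) Finset.univ_nonempty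
  set W := ∑ r, (s r)⁻¹ with hWdef
  -- the key identity: Σ w² s − 1/W = Σ s (w − s⁻¹/W)²
  have key : ∑ r, w r ^ 2 * s r - W⁻¹ = ∑ r, s r * (w r - (s r)⁻¹ / W) ^ 2 := by
    have e : ∀ r, s r * (w r - (s r)⁻¹ / W) ^ 2
        = w r ^ 2 * s r - 2 * w r / W + (s r)⁻¹ / W ^ 2 := fun r => by
      field_simp [(hs r).ne']
      ring
    simp only [e, Finset.sum_add_distrib, Finset.sum_sub_distrib]
    rw [← Finset.sum_div, ← Finset.sum_div, ← hWdef]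
    have : ∑ r, 2 * w r = 2 := by rw [← Finset.mul_sum, hw, mul_one]
    rw [this]
    field_simp
    ring
  constructor
  · intro heq
    have h0 : ∑ r, s r * (w r - (s r)⁻¹ / W) ^ 2 = 0 := by rw [← key, heq, sub_self]
    have hterm := (Finset.sum_eq_zero_iff_of_nonneg fun r _ =>
      mul_nonneg (hs r).le (sq_nonneg _)).1 h0
    intro r
    have hr := hterm r (Finset.mem_univ r)
    rcases mul_eq_zero.1 hr with h1 | h1
    · exact absurd h1 (hs r).ne'
    · exact sub_eq_zero.1 (pow_eq_zero_iff two_ne_zero |>.1 h1)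
  · intro hwr
    have h0 : ∑ r, s r * (w r - (s r)⁻¹ / W) ^ 2 = 0 :=
      Finset.sum_eq_zero fun r _ => by rw [hwr r, sub_self, zero_pow two_ne_zero, mul_zero]
    rw [← key] at h0
    linarith

/-- **Two codes: plain average versus pooling.**  `s_A, s_B > 0`:
`((s_A + s_B)/4) / (s_A⁻¹ + s_B⁻¹)⁻¹ = (s_A + s_B)²/(4 s_A s_B)`, which is `≥ 1` with equality iff
`s_A = s_B` — the asymptotic squared-width ratio of the `(A+B)/2` interval to the pooled one. [ours] -/
theorem average_vs_pooled_two {sA sB : ℝ} (hA : 0 < sA) (hB : 0 < sB) :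
    ((sA + sB) / 4) / (sA⁻¹ + sB⁻¹)⁻¹ = (sA + sB) ^ 2 / (4 * sA * sB)
      ∧ 1 ≤ (sA + sB) ^ 2 / (4 * sA * sB)
      ∧ ((sA + sB) ^ 2 / (4 * sA * sB) = 1 ↔ sA = sB) := by
  have hAB : 0 < 4 * sA * sB := by positivity
  refine ⟨?_, ?_, ?_⟩
  · field_simp
    ring
  · rw [le_div_iff₀ hAB, one_mul]
    nlinarith [sq_nonneg (sA - sB)]
  · rw [div_eq_one_iff_eq hAB.ne']
    constructor
    · intro h
      have : (sA - sB) ^ 2 = 0 := by nlinarith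
      exact sub_eq_zero.1 (pow_eq_zero_iff two_ne_zero |>.1 this)
    · intro h
      rw [h]
      ring

/-- **Scale identity for a fixed-weight combination**: for `n ≥ 1`,
`(Σ_r w_r x_r − a)² ≤ z²·Σ_r w_r² v_r ↔ (Σ_r w_r √n(x_r − a))² ≤ z²·Σ_r w_r² (n v_r)` when `Σ_r w_r = 1`.
[ours] -/
theorem weighted_event_scale_iff {n : ℕ} (hn : 1 ≤ n) (x v w : Fin R → ℝ) (hw : ∑ r, w r = 1)
    (a z : ℝ) :
    (∑ r, w r * x r - a) ^ 2 ≤ z ^ 2 * ∑ r, w r ^ 2 * v r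
      ↔ (∑ r, w r * (Real.sqrt n * (x r - a))) ^ 2 ≤ z ^ 2 * ∑ r, w r ^ 2 * ((n : ℝ) * v r) := by
  have hn0 : (0 : ℝ) < n := by exact_mod_cast hn
  have e1 : ∑ r, w r * (Real.sqrt n * (x r - a)) = Real.sqrt n * (∑ r, w r * x r - a) := by
    calc ∑ r, w r * (Real.sqrt n * (x r - a))
        = ∑ r, (Real.sqrt n * (w r * x r) - Real.sqrt n * a * w r) :=
          Finset.sum_congr rfl fun r _ => by ring
      _ = Real.sqrt n * ∑ r, w r * x r - Real.sqrt n * a * ∑ r, w r := by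
          rw [Finset.sum_sub_distrib, Finset.mul_sum, Finset.mul_sum]
      _ = Real.sqrt n * (∑ r, w r * x r - a) := by rw [hw]; ring
  have e2 : ∑ r, w r ^ 2 * ((n : ℝ) * v r) = (n : ℝ) * ∑ r, w r ^ 2 * v r := by
    rw [Finset.mul_sum]
    refine Finset.sum_congr rfl fun r _ => ?_
    ring
  rw [e1, e2, mul_pow, Real.sq_sqrt hn0.le]
  constructor
  · intro h
    nlinarith
  · intro h
    nlinarith

end Algebra

/-! ## §2 Every fixed-weight combination of calibrated independent codes is calibrated -/

section Weighted

variable {n : ℕ} {Ωs : Fin (n + 2) → Type*} [∀ r, MeasurableSpace (Ωs r)]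
  {Ps : (r : Fin (n + 2)) → Measure (Ωs r)} [∀ r, IsProbabilityMeasure (Ps r)]
variable {Ω' : Type*} [MeasurableSpace Ω'] {P' : Measure Ω'} [IsProbabilityMeasure P']

/-- **The law of the limit**: independent `Z_r ∼ N(0, s_r)` (`s_r > 0`), weights with
`Σ_r w_r² s_r > 0`: `P'((Σ_r w_r Z_r)/√(Σ_r w_r² s_r) ∈ A) = N(0,1)(A)`. [ours] -/
theorem measure_weighted_limit_preimage_eq {Z : Fin (n + 2) → Ω' → ℝ} {s : Fin (n + 2) → ℝ}
    (hs : ∀ r, 0 < s r) (hZm : ∀ r, Measurable (Z r))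
    (hZ : ∀ r, HasLaw (Z r) (gaussianReal 0 (s r).toNNReal) P') (hind : iIndepFun Z P')
    (w : Fin (n + 2) → ℝ) (hws : 0 < ∑ r, w r ^ 2 * s r) {A : Set ℝ} (hA : MeasurableSet A) :
    P' {ω' | (∑ r, w r * Z r ω') / Real.sqrt (∑ r, w r ^ 2 * s r) ∈ A} = gaussianReal 0 1 A := by
  have hlaw := hasLaw_standardise_pi hs hZm hZ hind
  set c := ∑ r, w r ^ 2 * s r with hc
  set u : Fin (n + 2) → ℝ := fun r => w r * Real.sqrt (s r) / Real.sqrt c with hu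
  have hu1 : ∑ i, u i ^ 2 = 1 := by
    simp only [hu, div_pow, mul_pow, Real.sq_sqrt (hs _).le, Real.sq_sqrt hws.le]
    rw [← Finset.sum_div, ← hc, div_self hws.ne']
  have hT : MeasurableSet {z : Fin (n + 2) → ℝ | ∑ i, u i * z i ∈ A} :=
    (by fun_prop : Measurable fun z : Fin (n + 2) → ℝ => ∑ i, u i * z i) hA
  have hpre : {ω' | (∑ r, w r * Z r ω') / Real.sqrt (∑ r, w r ^ 2 * s r) ∈ A}
      = (fun ω' (r : Fin (n + 2)) => Z r ω' / Real.sqrt (s r)) ⁻¹'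
        {z : Fin (n + 2) → ℝ | ∑ i, u i * z i ∈ A} := by
    ext ω'
    simp only [Set.mem_setOf_eq, Set.mem_preimage, hu]
    have e : ∑ i, w i * Real.sqrt (s i) / Real.sqrt c * (Z i ω' / Real.sqrt (s i))
        = (∑ r, w r * Z r ω') / Real.sqrt c := by
      rw [Finset.sum_div]
      refine Finset.sum_congr rfl fun i _ => ?_
      have hsi : Real.sqrt (s i) ≠ 0 := (Real.sqrt_pos.2 (hs i)).ne'
      field_simp
    rw [e, hc]
  rw [hpre, ← Measure.map_apply_of_aemeasurable hlaw.aemeasurable hT, hlaw.map_eq]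
  exact pi_gaussianReal_linear_preimage_eq u hu1 hA

set_option maxHeartbeats 400000 in
/-- **EVERY FIXED-WEIGHT COMBINATION IS CALIBRATED.**  `R = n + 2 ≥ 2` codes with the same target
`a`, `√k(Sₖ^r − a) ⇒ N(0, s_r)` (`s_r > 0`) independent, `k·V̂ₖ^r → s_r` a.s.; weights with
`Σ_r w_r = 1`.  Then for every `z`,
`P((Σ_r w_r Sₖ^r − a)² ≤ z²·Σ_r w_r² V̂ₖ^r) → N(0,1)([−|z|, |z|])`. [ours] -/
theorem kArm_weighted_coverage {S V : (r : Fin (n + 2)) → ℕ → Ωs r → ℝ} {a : ℝ}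
    {s : Fin (n + 2) → ℝ} {Z : Fin (n + 2) → Ω' → ℝ} (hs : ∀ r, 0 < s r)
    (hSm : ∀ r k, Measurable (S r k)) (hVm : ∀ r k, Measurable (V r k))
    (hclt : ∀ r, TendstoInDistribution (fun (k : ℕ) ω => Real.sqrt k * (S r k ω - a)) atTop (Z r)
      (fun _ => Ps r) P')
    (hZm : ∀ r, Measurable (Z r)) (hZ : ∀ r, HasLaw (Z r) (gaussianReal 0 (s r).toNNReal) P')
    (hind : iIndepFun Z P')
    (hV : ∀ r, ∀ᵐ ω ∂(Ps r), Tendsto (fun k : ℕ => (k : ℝ) * V r k ω) atTop (𝓝 (s r)))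
    (w : Fin (n + 2) → ℝ) (hw : ∑ r, w r = 1) (z : ℝ) :
    Tendsto (fun k : ℕ => (Measure.pi Ps).real {ω : (r : Fin (n + 2)) → Ωs r |
        (∑ r, w r * S r k (ω r) - a) ^ 2 ≤ z ^ 2 * ∑ r, w r ^ 2 * V r k (ω r)})
      atTop (𝓝 ((gaussianReal 0 1).real (Icc (-|z|) |z|))) := by
  -- some weight is non-zero, so `Σ w² s > 0`
  have hws : 0 < ∑ r, w r ^ 2 * s r := by
    obtain ⟨r₀, -, hr₀⟩ : ∃ r ∈ Finset.univ, w r ≠ 0 :=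
      Finset.exists_ne_zero_of_sum_ne_zero (by rw [hw]; exact one_ne_zero)
    exact lt_of_lt_of_le (mul_pos (pow_pos (abs_pos.2 hr₀) 2 |>.trans_eq (sq_abs _)) (hs r₀))
      (Finset.single_le_sum (fun r _ => mul_nonneg (sq_nonneg _) (hs r).le) (Finset.mem_univ r₀))
  -- Step 1: joint convergence of the scaled columns and of the error-bar vector
  have hXm : ∀ r (k : ℕ), Measurable fun ω : Ωs r => Real.sqrt (k : ℝ) * (S r k ω - a) :=
    fun r k => ((hSm r k).sub_const a).const_mul _
  have hY := CardConsistency.tendstoInDistribution_replicas (Ps := Ps) hclt hXm hZm hind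
  have hWm : ∀ k : ℕ, Measurable fun (ω : (r : Fin (n + 2)) → Ωs r) (r : Fin (n + 2)) =>
      ((k : ℕ) : ℝ) * V r k (ω r) :=
    fun k => measurable_pi_lambda _ fun r => ((hVm r k).comp (measurable_pi_apply r)).const_mul _
  have hae : ∀ᵐ ω ∂(Measure.pi Ps), ∀ r, Tendsto (fun k : ℕ => (k : ℝ) * V r k (ω r)) atTop (𝓝 (s r)) := by
    rw [ae_all_iff]
    intro r
    exact (Measure.quasiMeasurePreserving_eval Ps r).ae (hV r)
  have hWm' : ∀ k : ℕ, Measurable fun (ω : (r : Fin (n + 2)) → Ωs r) =>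
      (toLp 2 (fun r : Fin (n + 2) => ((k : ℕ) : ℝ) * V r k (ω r)) : EuclideanSpace ℝ (Fin (n + 2))) :=
    fun k => (WithLp.measurable_toLp 2 _).comp (hWm k)
  have hW : TendstoInMeasure (Measure.pi Ps) (fun (k : ℕ) (ω : (r : Fin (n + 2)) → Ωs r) =>
      (toLp 2 (fun r : Fin (n + 2) => ((k : ℕ) : ℝ) * V r k (ω r)) : EuclideanSpace ℝ (Fin (n + 2))))
      atTop (fun _ => (toLp 2 s : EuclideanSpace ℝ (Fin (n + 2)))) := by
    refine tendstoInMeasure_of_tendsto_ae (fun k => (hWm' k).aestronglyMeasurable) ?_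
    filter_upwards [hae] with ω hω
    exact ((PiLp.continuous_toLp 2 (fun _ : Fin (n + 2) => ℝ)).tendsto s).comp (tendsto_pi_nhds.2 hω)
  -- Step 2: Slutsky with the (unclamped, polynomial) functional `G`
  set G : EuclideanSpace ℝ (Fin (n + 2)) × EuclideanSpace ℝ (Fin (n + 2)) → ℝ := fun p =>
    (∑ r, w r * p.1 r) ^ 2 - z ^ 2 * ∑ r, w r ^ 2 * p.2 r with hG
  have hGc : Continuous G := by
    have hc1 : ∀ r : Fin (n + 2), Continuous fun p : EuclideanSpace ℝ (Fin (n + 2))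
        × EuclideanSpace ℝ (Fin (n + 2)) => p.1 r :=
      fun r => (PiLp.continuous_apply 2 _ r).comp continuous_fst
    have hc2 : ∀ r : Fin (n + 2), Continuous fun p : EuclideanSpace ℝ (Fin (n + 2))
        × EuclideanSpace ℝ (Fin (n + 2)) => p.2 r :=
      fun r => (PiLp.continuous_apply 2 _ r).comp continuous_snd
    simp only [hG]
    fun_prop
  have hsl := hY.continuous_comp_prodMk_of_tendstoInMeasure_const hGc hW (fun k => (hWm' k).aemeasurable)
  have hlim : (fun ω' => G ((toLp 2 fun r => Z r ω' : EuclideanSpace ℝ (Fin (n + 2))),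
        (toLp 2 s : EuclideanSpace ℝ (Fin (n + 2)))))
      = fun ω' => (∑ r, w r * Z r ω') ^ 2 - z ^ 2 * ∑ r, w r ^ 2 * s r := by
    funext ω'
    simp only [hG]
  rw [hlim] at hsl
  -- Step 3: portmanteau on `Iic 0`; the limit has no atom at `0`
  have hLm : Measurable fun ω' => (∑ r, w r * Z r ω') ^ 2 - z ^ 2 * ∑ r, w r ^ 2 * s r := by fun_prop
  have hlawT : ∀ {T : Set ℝ}, MeasurableSet T →
      P' {ω' | (∑ r, w r * Z r ω') ^ 2 - z ^ 2 * ∑ r, w r ^ 2 * s r ∈ T}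
        = gaussianReal 0 1 {t | t ^ 2 * (∑ r, w r ^ 2 * s r) - z ^ 2 * ∑ r, w r ^ 2 * s r ∈ T} := by
    intro T hT
    have hT' : MeasurableSet {t : ℝ | t ^ 2 * (∑ r, w r ^ 2 * s r) - z ^ 2 * ∑ r, w r ^ 2 * s r ∈ T} :=
      (by fun_prop : Measurable fun t : ℝ => t ^ 2 * (∑ r, w r ^ 2 * s r) - z ^ 2 * ∑ r, w r ^ 2 * s r) hT
    have h1 := measure_weighted_limit_preimage_eq hs hZm hZ hind w hws hT'
    have e : {ω' | (∑ r, w r * Z r ω') / Real.sqrt (∑ r, w r ^ 2 * s r)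
        ∈ {t : ℝ | t ^ 2 * (∑ r, w r ^ 2 * s r) - z ^ 2 * ∑ r, w r ^ 2 * s r ∈ T}}
        = {ω' | (∑ r, w r * Z r ω') ^ 2 - z ^ 2 * ∑ r, w r ^ 2 * s r ∈ T} := by
      ext ω'
      simp only [Set.mem_setOf_eq, div_pow, Real.sq_sqrt hws.le, div_mul_cancel₀ _ hws.ne']
    rw [e] at h1
    exact h1
  have hfr : (P'.map fun ω' => (∑ r, w r * Z r ω') ^ 2 - z ^ 2 * ∑ r, w r ^ 2 * s r)
      (frontier (Iic 0)) = 0 := by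
    rw [frontier_Iic, Measure.map_apply hLm (measurableSet_singleton _)]
    have h1 := hlawT (measurableSet_singleton (0 : ℝ))
    simp only [Set.mem_singleton_iff] at h1
    rw [show ((fun ω' => (∑ r, w r * Z r ω') ^ 2 - z ^ 2 * ∑ r, w r ^ 2 * s r) ⁻¹' {0})
      = {ω' | (∑ r, w r * Z r ω') ^ 2 - z ^ 2 * ∑ r, w r ^ 2 * s r = 0} from rfl, h1]
    have hsub : {t : ℝ | t ^ 2 * (∑ r, w r ^ 2 * s r) - z ^ 2 * ∑ r, w r ^ 2 * s r = 0} ⊆ {z, -z} := by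
      intro t ht
      simp only [Set.mem_setOf_eq] at ht
      have ht' : t ^ 2 = z ^ 2 := by
        have : (t ^ 2 - z ^ 2) * ∑ r, w r ^ 2 * s r = 0 := by rw [sub_mul]; exact ht
        rcases mul_eq_zero.1 this with h0 | h0
        · exact sub_eq_zero.1 h0
        · exact absurd h0 hws.ne'
      rcases sq_eq_sq_iff_eq_or_eq_neg.1 ht' with h2 | h2
      · simp [h2]
      · simp [h2]
    exact measure_mono_null hsub (by
      haveI := nullSingletonClass_gaussianReal (μ := 0) one_ne_zero
      exact (Set.toFinite _).measure_zero _)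
  have hconv := CardConsistency.tendsto_measureReal_preimage_of_tendstoInDistribution hsl
    measurableSet_Iic hfr
  -- identify both sides
  have hlimit : P'.real ((fun ω' => (∑ r, w r * Z r ω') ^ 2 - z ^ 2 * ∑ r, w r ^ 2 * s r) ⁻¹' Iic 0)
      = (gaussianReal 0 1).real (Icc (-|z|) |z|) := by
    simp only [measureReal_def]
    congr 1
    have h1 := hlawT (measurableSet_Iic (a := (0 : ℝ)))
    rw [show ((fun ω' => (∑ r, w r * Z r ω') ^ 2 - z ^ 2 * ∑ r, w r ^ 2 * s r) ⁻¹' Iic 0)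
      = {ω' | (∑ r, w r * Z r ω') ^ 2 - z ^ 2 * ∑ r, w r ^ 2 * s r ∈ Iic (0 : ℝ)} from rfl, h1,
      ← setOf_sq_le_sq_eq_Icc]
    congr 1
    ext t
    simp only [Set.mem_setOf_eq, Set.mem_Iic, sub_nonpos]
    exact mul_le_mul_iff_of_pos_right hws
  rw [hlimit] at hconv
  refine hconv.congr' ?_
  filter_upwards [eventually_ge_atTop 1] with k hk1
  congr 1
  ext ω
  simp only [Set.mem_setOf_eq, Set.mem_preimage, Set.mem_Iic, hG, sub_nonpos]
  exact (weighted_event_scale_iff hk1 (fun r => S r k (ω r)) (fun r => V r k (ω r)) w hw a z).symm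

/-- **The weighted error bar**: `k·Σ_r w_r² V̂ₖ^r → Σ_r w_r² s_r` almost surely. [ours] -/
theorem ae_tendsto_scaled_weightedErrorBar {V : (r : Fin (n + 2)) → ℕ → Ωs r → ℝ}
    {s : Fin (n + 2) → ℝ} (w : Fin (n + 2) → ℝ)
    (hV : ∀ r, ∀ᵐ ω ∂(Ps r), Tendsto (fun k : ℕ => (k : ℝ) * V r k ω) atTop (𝓝 (s r))) :
    ∀ᵐ ω ∂(Measure.pi Ps), Tendsto (fun k : ℕ => (k : ℝ) * ∑ r, w r ^ 2 * V r k (ω r)) atTop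
      (𝓝 (∑ r, w r ^ 2 * s r)) := by
  have hae : ∀ᵐ ω ∂(Measure.pi Ps), ∀ r, Tendsto (fun k : ℕ => (k : ℝ) * V r k (ω r)) atTop (𝓝 (s r)) := by
    rw [ae_all_iff]
    intro r
    exact (Measure.quasiMeasurePreserving_eval Ps r).ae (hV r)
  filter_upwards [hae] with ω hω
  have h1 : Tendsto (fun k : ℕ => ∑ r, w r ^ 2 * ((k : ℝ) * V r k (ω r))) atTop
      (𝓝 (∑ r, w r ^ 2 * s r)) :=
    tendsto_finsetSum _ fun r _ => (hω r).const_mul _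
  refine h1.congr fun k => ?_
  rw [Finset.mul_sum]
  refine Finset.sum_congr rfl fun r _ => ?_
  ring

end Weighted

end Summit.Ventures.LatticeQCDFlow.Scoring
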